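import Mathlib.Algebra.CharP.Lemmas
import Mathlib.Algebra.MonoidAlgebra.Basic
import Mathlib.RingTheory.LocalRing.ResidueField.Basic
import Summits.BirchSwinnertonDyer.BirchSwinnertonDyer.Theorems.KatoDescentPotSupersingularZetaBodyRefitUnconditional
import HarnessLib

/-!
# Tightness lemma for the rank-ONE residual (K9 `WildRankOne` 19200 / KT `TameRankOne` 19984), PART 20c:
# which single-character pins survive the group-ring refits — characters of `p`-power order

Cell `bsd-potss` (FULL-BSD rank ≤ 1, tranche 1b), seat `bsd-potss-kmc`, generation 13, part 20c; memo
HOME/bsd-potss-kmc/KMC-DESCENT-MEMO-v12.md (F7 of memo v11 §2.3 in kernel).  ROUTE-FREE;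
`--supports stmt-BirchSwinnertonDyer-19200`.  Proofs only (generic commutative algebra).

WHAT THIS SHOWS.  By PART 19/20 (`zetaBody_refit_unconditional`, this namespace) the zeta data of
`Kato2004.ZetaBody` admit the refits `(κ, Λ, z, x) ↦ (κ, Λ ∘ θ⁻¹, θ•z, x)` for `θ = σ̃ + c ∈ ℤ_p[Γ_ℚ]`:
the bottom class is multiplied by the AUGMENTATION `θ(𝟙) = 1 + c` (`refit_bottom`) while a functional
pinned on a `χ`-eigenclass of `σ̃` is divided by the CHARACTER VALUE `χ(θ) = χ(σ̃) + c`
(`smul_refit_levelFunctional_of_eigen`).  A single-character pin with an EXPLICIT image exponent is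
therefore refit-invariant exactly when `χ(θ) unit ⟺ θ(𝟙) unit`.  Here, for a local ring `𝒪` with residue
characteristic `p` (e.g. `ℤ_p[ζ_{p^a}]`):
* `sub_one_mem_maximalIdeal_of_pow_prime_pow_eq_one`: every `p`-power root of unity is `≡ 1 (mod 𝔪)`;
* `lift_sub_lift_one_mem`: for a character `χ : G → 𝒪ˣ` with all `χ(g) ≡ 1 (mod I)` and every element
  `θ` of the group ring `𝒪[G]`, `χ(θ) ≡ θ(𝟙) (mod I)` (`θ(𝟙)` = augmentation);
* `isUnit_lift_iff_isUnit_aug`: hence for `χ` of `p`-power order, `χ(θ) ∈ 𝒪ˣ ⟺ θ(𝟙) ∈ 𝒪ˣ`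
  (and `isUnit_add_iff_of_pow_prime_pow_eq_one`: `χ(σ̃) + c ∈ 𝒪ˣ ⟺ 1 + c ∈ 𝒪ˣ` for the refits
  `θ = σ̃ + c`).
Contrast (memo v11 F6/F7, V95–V99): for a character of order PRIME TO `p`, e.g. `χ(σ̃) = −1`, `c = p − 1`,
`p` odd, `χ(θ) = p − 2` is a unit while `θ(𝟙) = p` is not — such pins are moved by refits.  So among
single-character pins only those at characters `χ ≡ 𝟙 (mod 𝔭)` — i.e. of `p`-power order — with an
explicit exponent are compatible with the refit symmetry (the CONGRUENT PIN of memo v11 §3; v12 §2–§3).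
Nothing about BSD is asserted; 19200/19984 stay declared residuals.

References (context only; the lemmas below are folklore commutative algebra): Rubin, PCMI lectures
(2011) §4.1 [Rubin2011] (the group-ring module of Euler systems); C.-H. Kim, AJM (arXiv:2203.12159)
Thm. 1.4 (blind spots / `Λ`-primitivity of Kato's Kolyvagin system, used in the memo's F8).
-/

set_option autoImplicit false
-- the D-0017 layout forces the namespace `Summit.BirchSwinnertonDyer.BirchSwinnertonDyer.…` (repeated component)
set_option linter.dupNamespace false

noncomputable section

namespace Summit.BirchSwinnertonDyer.BirchSwinnertonDyer.Theorems.ZetaBodyRefit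

/-! ## §1 `p`-power roots of unity are `≡ 1` modulo the maximal ideal -/

section RootsOfUnity

variable {𝒪 : Type*} [CommRing 𝒪] [IsLocalRing 𝒪] {p : ℕ} [Fact p.Prime]
  [CharP (IsLocalRing.ResidueField 𝒪) p]

/-- **A `p`-power root of unity in a local ring of residue characteristic `p` is `≡ 1 (mod 𝔪)`:**
`u^{p^a} = 1 ⟹ u − 1 ∈ 𝔪` (in the residue field `(ū − 1)^{p^a} = ū^{p^a} − 1 = 0`).  E.g. `ζ_{p^a} − 1`
lies in the maximal ideal of `ℤ_p[ζ_{p^a}]`; so a character of `p`-power ORDER takes values `≡ 1 (mod 𝔪)`.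
[folklore] -/
theorem sub_one_mem_maximalIdeal_of_pow_prime_pow_eq_one {u : 𝒪} {a : ℕ} (hu : u ^ p ^ a = 1) :
    u - 1 ∈ IsLocalRing.maximalIdeal 𝒪 := by
  rw [← IsLocalRing.residue_eq_zero_iff, map_sub, map_one]
  have h : (IsLocalRing.residue 𝒪 u - 1) ^ p ^ a = 0 := by
    rw [sub_pow_char_pow, ← map_pow, hu, map_one, one_pow, sub_self]
  exact pow_eq_zero_iff (pow_ne_zero a (Fact.out : p.Prime).ne_zero) |>.mp h

/-- In a local ring, elements congruent modulo the maximal ideal are units together: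
`a − b ∈ 𝔪 ⟹ (a ∈ 𝒪ˣ ⟺ b ∈ 𝒪ˣ)`. [folklore] -/
theorem isUnit_iff_isUnit_of_sub_mem_maximalIdeal {R : Type*} [CommRing R] [IsLocalRing R] {a b : R}
    (h : a - b ∈ IsLocalRing.maximalIdeal R) : IsUnit a ↔ IsUnit b := by
  rw [← IsLocalRing.residue_ne_zero_iff_isUnit, ← IsLocalRing.residue_ne_zero_iff_isUnit,
    ← sub_eq_zero.mp ((map_sub (IsLocalRing.residue R) a b).symm.trans
      ((IsLocalRing.residue_eq_zero_iff _).mpr h))]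

/-- **The refit `θ = σ̃ + c` seen by a `p`-power-order character:** if `u = χ(σ̃)` satisfies
`u^{p^a} = 1` then `χ(θ) = u + c` is a unit iff the augmentation `θ(𝟙) = 1 + c` is a unit.  So an
EXPLICIT-exponent pin at such a `χ` admits exactly the refits that do not move the `p`-divisibility
position of the bottom class (`refit_bottom`, `smul_refit_levelFunctional_of_eigen`); contrast
`χ(σ̃) = −1`, `c = p − 1`, `p` odd: `p − 2 ∈ ℤ_pˣ`, `p ∉ ℤ_pˣ`. [folklore] -/
theorem isUnit_add_iff_of_pow_prime_pow_eq_one {u : 𝒪} {a : ℕ} (hu : u ^ p ^ a = 1) (c : 𝒪) :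
    IsUnit (u + c) ↔ IsUnit (1 + c) :=
  isUnit_iff_isUnit_of_sub_mem_maximalIdeal (by
    rw [show u + c - (1 + c) = u - 1 by ring]
    exact sub_one_mem_maximalIdeal_of_pow_prime_pow_eq_one hu)

end RootsOfUnity

/-! ## §2 Group-ring elements: `χ(θ) ≡ θ(𝟙)` modulo `I` when `χ ≡ 𝟙 (mod I)` -/

section GroupRing

variable {𝒪 : Type*} [CommRing 𝒪] {G : Type*} [Monoid G]

/-- **`χ(θ) ≡ θ(𝟙) (mod I)`:** for a character `χ : G → 𝒪` (monoid hom) with `χ(g) − 1 ∈ I` for all `g`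
and every element `θ = Σ a_g g` of the group ring `𝒪[G]`, the value `χ(θ) = Σ a_g χ(g)` and the
augmentation `θ(𝟙) = Σ a_g` are congruent modulo `I` (`χ(θ) − θ(𝟙) = Σ a_g (χ(g) − 1)`).
[folklore] -/
theorem lift_sub_lift_one_mem (I : Ideal 𝒪) (χ : G →* 𝒪) (hχ : ∀ g, χ g - 1 ∈ I)
    (θ : MonoidAlgebra 𝒪 G) :
    MonoidAlgebra.lift 𝒪 𝒪 G χ θ - MonoidAlgebra.lift 𝒪 𝒪 G 1 θ ∈ I := by
  rw [MonoidAlgebra.lift_apply, MonoidAlgebra.lift_apply, ← Finsupp.sum_sub]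
  refine I.sum_mem fun g _ ↦ ?_
  dsimp only
  rw [MonoidHom.one_apply, ← smul_sub, smul_eq_mul]
  exact I.mul_mem_left _ (hχ g)

/-- **Units together:** over a LOCAL ring, if `χ ≡ 𝟙 (mod 𝔪)` then `χ(θ) ∈ 𝒪ˣ ⟺ θ(𝟙) ∈ 𝒪ˣ` for every
`θ ∈ 𝒪[G]`. [folklore] -/
theorem isUnit_lift_iff_isUnit_aug_of_sub_one_mem [IsLocalRing 𝒪] (χ : G →* 𝒪)
    (hχ : ∀ g, χ g - 1 ∈ IsLocalRing.maximalIdeal 𝒪) (θ : MonoidAlgebra 𝒪 G) :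
    IsUnit (MonoidAlgebra.lift 𝒪 𝒪 G χ θ) ↔ IsUnit (MonoidAlgebra.lift 𝒪 𝒪 G 1 θ) :=
  isUnit_iff_isUnit_of_sub_mem_maximalIdeal (lift_sub_lift_one_mem _ χ hχ θ)

/-- **Characters of `p`-power order pin the augmentation** (memo v11 F7 §2.3): for a local ring `𝒪`
of residue characteristic `p` and a character `χ : G → 𝒪` of `p`-power order (`χ(g)^{p^a} = 1` for
all `g`), every group-ring element `θ ∈ 𝒪[G]` has `χ(θ) ∈ 𝒪ˣ ⟺ θ(𝟙) ∈ 𝒪ˣ`.  Consequence for the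
refits of `ZetaBody` data (`zetaBody_refit_unconditional`): a pin with EXPLICIT image exponent at such a
`χ` (the CONGRUENT PIN) is only compatible with refits whose augmentation is a unit, which leave the
`p`-divisibility position of the bottom class unchanged; characters of order prime to `p` give no such
constraint. [folklore] -/
theorem isUnit_lift_iff_isUnit_aug [IsLocalRing 𝒪] {p : ℕ} [Fact p.Prime]
    [CharP (IsLocalRing.ResidueField 𝒪) p] (χ : G →* 𝒪) {a : ℕ} (hχ : ∀ g, χ g ^ p ^ a = 1)
    (θ : MonoidAlgebra 𝒪 G) :
    IsUnit (MonoidAlgebra.lift 𝒪 𝒪 G χ θ) ↔ IsUnit (MonoidAlgebra.lift 𝒪 𝒪 G 1 θ) :=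
  isUnit_lift_iff_isUnit_aug_of_sub_one_mem χ
    (fun g ↦ sub_one_mem_maximalIdeal_of_pow_prime_pow_eq_one (hχ g)) θ

end GroupRing

end Summit.BirchSwinnertonDyer.BirchSwinnertonDyer.Theorems.ZetaBodyRefit

end
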